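import Summits.HubbardSuperconductivity.HubbardSuperconductivity.Theorems.AnisotropyChordTransferFibre3RowDTOrbit
import Summits.HubbardSuperconductivity.HubbardSuperconductivity.Theorems.AnisotropyChordTransferFibre3RowDTCheckS
import Summits.HubbardSuperconductivity.HubbardSuperconductivity.Theorems.AnisotropyChordTransferFibre3RowDTCellCheckW
import Summits.HubbardSuperconductivity.HubbardSuperconductivity.Theorems.AnisotropyChordTransferFibre3RowDTCellAdm

/-!
# Route `AnisotropyChord` / H0 rotor rung, LEVEL 2 row D on the t-BLOCKS: the CHECKER-AGNOSTIC cell layer (`…A` twins), part 2 of 3: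
# `lowG_of_orbitChecksA`, `lowG_of_orbitChecksSA`, `lowG_of_classChecksCA/WA`, `lowG_of_orbitChecksCA/WA`

The row-D T-fork (`…RowDT*`, namespace `RowD.T`) states its cell layer with `(hc : c.check = true)` (window/Jordan brackets); here the same
theorems with the checker-agnostic admissibility `(hc : c.Adm)` of `…L2TCellR` (fed by `TCell.adm_of_check` / `adm_of_checkR` — ASK 3 ring
brackets, route lead p1 g32), proofs verbatim with `pmem_xTrueTA` / `finalVec_mem_of_cellFinalBoxTA` and the `…A` names; programs (`rowDBox`,
`tauCheck`, `classCheck…`) and the analytic layer are reused unchanged.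
Prover seat `hubbard-h0-rotor-p2` g8; helper for piece A = stmt-HubbardSuperconductivity-23918 of rung 19089 (`--supports`, helper class).
Nothing here proves superconductivity in the Hubbard model; cell-layer plumbing of ONE conditional reduction (the GM₃ ∀L certificate, row D on
t-blocks).  Mathlib + the tree only; no sorry.
-/

set_option linter.dupNamespace false
set_option autoImplicit false

open scoped BigOperators
open Literature.Analysis.ValidatedNumerics

namespace Summit.HubbardSuperconductivity.HubbardSuperconductivity.Theorems.AnisotropyChord.Transfer.Fibre3

namespace RowD

namespace T

open RowC L2 L2.N1

variable (L : ℕ) [NeZero L]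

variable (Δ lam2 : ℝ) (f : Tor L → ℝ)

/-- ★★★ **ORBIT FORM of the row-D cell certificate**: representatives `reps = [(r_j, b_j)]` (each `r_j ∈ lowList` and passing ONE
kernel class check `classCheck … r_j b_j`, `hrepsCls`; `r_j ∈ lowList`, `hrepsMem`), an orbit table `orb = [(k, j, w)]` listing `lowList` with `w·k = r_j` (`orbitRowOk`,
pure integer `decide`), the budget `Σ_k b_{j(k)} ≤ 3·(98696/10⁴)·a_D·ν₁·τlo`, the `ê₁` check and the `τ` check give
`lowGForm ≤ a_D·η_eff·U` on the cell for every `L ≥ 128` — the `hKT2a` hypothesis of `gm3_of_cell`. -/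
theorem lowG_of_orbitChecksA (c : L2.TCell) (a1 a2 aD τlo τhi : ℚ) (pi piT : ℕ × ℕ)
    (reps : List (((ℤ × ℤ) × (ℤ × ℤ)) × ℚ)) (orb : List (((ℤ × ℤ) × (ℤ × ℤ)) × (ℕ × List ℕ)))
    (hrepsMem : (reps.all fun p => decide (p.1 ∈ lowList)) = true)
    (hrepsCls : (reps.all fun p => classCheck c a1 a2 τlo τhi pi p.1 p.2) = true)
    (horb : orb.map Prod.fst = lowList) (hok : (orb.all (orbitRowOk reps)) = true)
    (hsum : (orb.map (orbitBudget reps)).sum ≤ 3 * (98696 / 10000) * aD * ((c.n1 : ℚ) / c.νd) * τlo)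
    (haD : 0 ≤ aD) (hτlo0 : 0 ≤ τlo) (he1 : e1Check c a1 a2 τhi pi = true) (hτ : tauCheck c a1 a2 τlo τhi piT = true)
    (hc : c.Adm) (hL : 64 ≤ L) (hL0 : c.L0 ≤ L) (hL1 : c.L1 = 0 ∨ L ≤ c.L1)
    (hΔ0 : 0 ≤ Δ) (hΔ1 : Δ < 1) (hf : IsGroundTwoMagnon L Δ lam2 f)
    (hν1 : (c.n1 : ℝ) / c.νd ≤ lam2 / (2 * Real.pi / L) ^ 2) (hν2 : lam2 / (2 * Real.pi / L) ^ 2 ≤ (c.n2 : ℝ) / c.νd)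
    (ha1 : ((a1 : ℚ) : ℝ) ≤ Δ * f (K1 L)) (ha2 : Δ * f (K1 L) ≤ ((a2 : ℚ) : ℝ)) :
    lowGForm L Δ f ≤ (aD : ℝ) * etaEff L lam2 * Uunit L Δ f := by
  obtain ⟨hτlo, hτhi⟩ := tau_of_tauCheckA L Δ lam2 f c a1 a2 τlo τhi piT hτ hc hL hL0 hL1 hΔ0 hΔ1 hf hν1 hν2 ha1 ha2
  -- the box and the `ê₁` check
  unfold e1Check at he1
  split at he1
  · exact absurd he1 (by simp)
  · rename_i B hB
    have hmem := rowDBox_memA L Δ lam2 f c a1 a2 pi hB hc hL hL0 hL1 hΔ0 hΔ1 hf hν1 hν2 ha1 ha2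
    have e1 := rexprLeOn_sound he1 _ hmem
    simp only [RExpr.eval, cst, vE1, xTrueD_e1] at e1
    push_cast at e1
    have he1' : (τhi : ℝ) - 2 * (eps1 L / (2 * Real.pi / L) ^ 2) ≤ -1 / 1000 := by linarith
    -- the representatives: `T(r_j) ≤ V²t·b_j`
    have hrep : ∀ r ∈ reps, lowTerm L Δ f (B1.toTor L r.1.1) (B1.toTor L r.1.2)
        ≤ ((L : ℝ) ^ 2) ^ 2 * (2 * Real.pi / L) ^ 2 * ((r.2 : ℚ) : ℝ) := by
      intro r hr
      have hmemL : r.1 ∈ lowList := of_decide_eq_true (List.all_eq_true.mp hrepsMem r hr)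
      have hcls := List.all_eq_true.mp hrepsCls r hr
      have h1 := class_le L Δ lam2 f hL hΔ0 hΔ1 hf τlo τhi hτlo hτhi he1' hmemL
      unfold classCheck at hcls
      rw [hB] at hcls
      have h3 := rexprLeOn_sound hcls _ hmem
      exact h1.trans (mul_le_mul_of_nonneg_left h3 (by positivity))
    -- the rows: `T(k) = T(w·k) = T(r_j) ≤ V²t·b_j`
    refine lowG_of_rowBounds L Δ lam2 f (by omega) hΔ1 hf c aD τlo (orb.map fun row => (row.1, orbitBudget reps row))
      (by rw [List.map_map]; exact horb) ?_ (by rw [List.map_map]; exact hsum) haD hτlo0 hτlo hν1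
    intro p hp
    obtain ⟨row, hrow, rfl⟩ := List.mem_map.mp hp
    have hok1 := List.all_eq_true.mp hok row hrow
    unfold orbitRowOk at hok1
    unfold orbitBudget
    split at hok1
    · exact absurd hok1 (by simp)
    · rename_i r hr
      have hw : wordZ row.2.2 row.1 = r.1 := of_decide_eq_true hok1
      have hrmem : r ∈ reps := List.mem_of_getElem? hr
      have key := lowTerm_wordZ L (by omega) hf row.2.2 row.1
      rw [hw] at key
      show lowTerm L Δ f (B1.toTor L row.1.1) (B1.toTor L row.1.2) ≤ _
      rw [← key]
      exact hrep r hrmem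

/-- ★★★ **ORBIT FORM of the row-D cell certificate with FIRST-ORDER class checks**: two representative tables, `repsZ = [(r_j, b_j)]`
certified by p1's ZERO-ORDER `classCheck` and `repsS = [(r_j, b_j)]` certified by the FIRST-ORDER `classCheckS` (the orbit table indexes
`repsZ ++ repsS`; a generator puts each representative where its budget is smaller — the slope bound loses slightly on tiny classes through the
`|·|` remainder), each representative in `lowList`, an orbit table `orb = [(k, j, w)]` listing `lowList` with `w·k = r_j` (`orbitRowOk`), the budget
`Σ_k b_{j(k)} ≤ 3·(98696/10⁴)·a_D·ν₁·τlo`, the `ê₁` check and the `τ` check give `lowGForm ≤ a_D·η_eff·U` on the cell for every `L ≥ 128` —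
the `hKT2a` hypothesis of `gm3_of_cell` (same conclusion as `lowG_of_orbitChecksA`, which is the case `repsS = []`). -/
theorem lowG_of_orbitChecksSA (c : L2.TCell) (a1 a2 aD τlo τhi : ℚ) (pi piT : ℕ × ℕ)
    (repsZ repsS : List (((ℤ × ℤ) × (ℤ × ℤ)) × ℚ)) (orb : List (((ℤ × ℤ) × (ℤ × ℤ)) × (ℕ × List ℕ)))
    (hrepsMem : ((repsZ ++ repsS).all fun p => decide (p.1 ∈ lowList)) = true)
    (hrepsZ : (repsZ.all fun p => classCheck c a1 a2 τlo τhi pi p.1 p.2) = true)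
    (hrepsS : (repsS.all fun p => classCheckS c a1 a2 τlo τhi pi p.1 p.2) = true)
    (horb : orb.map Prod.fst = lowList) (hok : (orb.all (orbitRowOk (repsZ ++ repsS))) = true)
    (hsum : (orb.map (orbitBudget (repsZ ++ repsS))).sum ≤ 3 * (98696 / 10000) * aD * ((c.n1 : ℚ) / c.νd) * τlo)
    (haD : 0 ≤ aD) (hτlo0 : 0 ≤ τlo) (he1 : e1Check c a1 a2 τhi pi = true) (hτ : tauCheck c a1 a2 τlo τhi piT = true)
    (hc : c.Adm) (hL : 64 ≤ L) (hL0 : c.L0 ≤ L) (hL1 : c.L1 = 0 ∨ L ≤ c.L1)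
    (hΔ0 : 0 ≤ Δ) (hΔ1 : Δ < 1) (hf : IsGroundTwoMagnon L Δ lam2 f)
    (hν1 : (c.n1 : ℝ) / c.νd ≤ lam2 / (2 * Real.pi / L) ^ 2) (hν2 : lam2 / (2 * Real.pi / L) ^ 2 ≤ (c.n2 : ℝ) / c.νd)
    (ha1 : ((a1 : ℚ) : ℝ) ≤ Δ * f (K1 L)) (ha2 : Δ * f (K1 L) ≤ ((a2 : ℚ) : ℝ)) :
    lowGForm L Δ f ≤ (aD : ℝ) * etaEff L lam2 * Uunit L Δ f := by
  have hLpos : (0 : ℝ) < L := by exact_mod_cast (show 0 < L by omega)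
  obtain ⟨hτlo, hτhi⟩ := tau_of_tauCheckA L Δ lam2 f c a1 a2 τlo τhi piT hτ hc hL hL0 hL1 hΔ0 hΔ1 hf hν1 hν2 ha1 ha2
  -- the box and the `ê₁` check
  unfold e1Check at he1
  split at he1
  · exact absurd he1 (by simp)
  · rename_i B hB
    have hmem := rowDBox_memA L Δ lam2 f c a1 a2 pi hB hc hL hL0 hL1 hΔ0 hΔ1 hf hν1 hν2 ha1 ha2
    have e1 := rexprLeOn_sound he1 _ hmem
    simp only [RExpr.eval, cst, vE1, xTrueD_e1] at e1
    push_cast at e1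
    have he1' : (τhi : ℝ) - 2 * (eps1 L / (2 * Real.pi / L) ^ 2) ≤ -1 / 1000 := by linarith
    -- the representatives: `T(r_j) ≤ V²t·b_j` (zero-order rows and first-order rows)
    have hrep : ∀ r ∈ repsZ ++ repsS, lowTerm L Δ f (B1.toTor L r.1.1) (B1.toTor L r.1.2)
        ≤ ((L : ℝ) ^ 2) ^ 2 * (2 * Real.pi / L) ^ 2 * ((r.2 : ℚ) : ℝ) := by
      intro r hr
      have hmemL : r.1 ∈ lowList := of_decide_eq_true (List.all_eq_true.mp hrepsMem r hr)
      have h1 := class_le L Δ lam2 f hL hΔ0 hΔ1 hf τlo τhi hτlo hτhi he1' hmemL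
      have h3 : (termE τlo τhi r.1.1 r.1.2).eval (xTrueD L Δ lam2 f) ≤ ((r.2 : ℚ) : ℝ) := by
        rcases List.mem_append.mp hr with hz | hs
        · have hcls := List.all_eq_true.mp hrepsZ r hz
          unfold classCheck at hcls
          rw [hB] at hcls
          exact rexprLeOn_sound hcls _ hmem
        · exact classCheckS_sound (List.all_eq_true.mp hrepsS r hs) hB hmem
      exact h1.trans (mul_le_mul_of_nonneg_left h3 (by positivity))
    -- the rows: `T(k) = T(w·k) = T(r_j) ≤ V²t·b_j`
    refine lowG_of_rowBounds L Δ lam2 f (by omega) hΔ1 hf c aD τlo (orb.map fun row => (row.1, orbitBudget (repsZ ++ repsS) row))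
      (by rw [List.map_map]; exact horb) ?_ (by rw [List.map_map]; exact hsum) haD hτlo0 hτlo hν1
    intro p hp
    obtain ⟨row, hrow, rfl⟩ := List.mem_map.mp hp
    have hok1 := List.all_eq_true.mp hok row hrow
    unfold orbitRowOk at hok1
    unfold orbitBudget
    split at hok1
    · exact absurd hok1 (by simp)
    · rename_i r hr
      have hw : wordZ row.2.2 row.1 = r.1 := of_decide_eq_true hok1
      have hrmem : r ∈ repsZ ++ repsS := List.mem_of_getElem? hr
      have key := lowTerm_wordZ L (by omega) hf row.2.2 row.1
      rw [hw] at key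
      show lowTerm L Δ f (B1.toTor L row.1.1) (B1.toTor L row.1.2) ≤ _
      rw [← key]
      exact hrep r hrmem

/-- ★★★ **PER-CLASS FORM, generic zone constant**: a budget table `tbl = [(k, b_k)]` listing the classes of `lowList` in order, each row certified by
`classCheckC czE` (one small kernel `decide` per class), with `Σ b_k ≤ 3·(98696/10000)·aD·ν₁·τlo` (`9.8696 < π²`, `ν₁ = n₁/νd` the cell's
lower `ν`), the `ê₁` check and the `τ` check give `lowG ≤ a_D·η_eff·U` on the cell. -/
theorem lowG_of_classChecksCA (czE : RExpr) (c : L2.TCell) {cz : ℝ} (hcz0 : 0 ≤ cz)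
    (hwg : ∀ q : Tor L, ∀ e ∈ E4, (wnorm L q (B1.toTor L e) * gres L lam2 q) ^ 2 ≤ cz * gres L lam2 q)
    (hcz : czE.eval (xTrueD L Δ lam2 f) = cz)
    (a1 a2 aD τlo τhi : ℚ) (pi piT : ℕ × ℕ) (tbl : List (((ℤ × ℤ) × (ℤ × ℤ)) × ℚ))
    (htbl : tbl.map Prod.fst = lowList)
    (hcls : (tbl.all fun p => classCheckC czE c a1 a2 τlo τhi pi p.1 p.2) = true)
    (hsum : (tbl.map Prod.snd).sum ≤ 3 * (98696 / 10000) * aD * ((c.n1 : ℚ) / c.νd) * τlo)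
    (haD : 0 ≤ aD) (hτlo0 : 0 ≤ τlo) (he1 : e1Check c a1 a2 τhi pi = true) (hτ : tauCheck c a1 a2 τlo τhi piT = true)
    (hc : c.Adm) (hL : 64 ≤ L) (hL0 : c.L0 ≤ L) (hL1 : c.L1 = 0 ∨ L ≤ c.L1)
    (hΔ0 : 0 ≤ Δ) (hΔ1 : Δ < 1) (hf : IsGroundTwoMagnon L Δ lam2 f)
    (hν1 : (c.n1 : ℝ) / c.νd ≤ lam2 / (2 * Real.pi / L) ^ 2) (hν2 : lam2 / (2 * Real.pi / L) ^ 2 ≤ (c.n2 : ℝ) / c.νd)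
    (ha1 : ((a1 : ℚ) : ℝ) ≤ Δ * f (K1 L)) (ha2 : Δ * f (K1 L) ≤ ((a2 : ℚ) : ℝ)) :
    lowGForm L Δ f ≤ (aD : ℝ) * etaEff L lam2 * Uunit L Δ f := by
  have hLpos : (0 : ℝ) < L := by exact_mod_cast (show 0 < L by omega)
  have ht : 0 < (2 * Real.pi / L : ℝ) ^ 2 := by positivity
  have hV : (0 : ℝ) < (L : ℝ) ^ 2 := by positivity
  obtain ⟨hτlo, hτhi⟩ := tau_of_tauCheckA L Δ lam2 f c a1 a2 τlo τhi piT hτ hc hL hL0 hL1 hΔ0 hΔ1 hf hν1 hν2 ha1 ha2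
  -- the box and the `ê₁` check
  unfold e1Check at he1
  split at he1
  · exact absurd he1 (by simp)
  · rename_i B hB
    have hmem := rowDBox_memA L Δ lam2 f c a1 a2 pi hB hc hL hL0 hL1 hΔ0 hΔ1 hf hν1 hν2 ha1 ha2
    have e1 := rexprLeOn_sound he1 _ hmem
    simp only [RExpr.eval, cst, vE1, xTrueD_e1] at e1
    push_cast at e1
    have he1' : (τhi : ℝ) - 2 * (eps1 L / (2 * Real.pi / L) ^ 2) ≤ -1 / 1000 := by linarith
    -- each row of the table: `term(k) ≤ V²t·termE.eval ≤ V²t·b_k`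
    have hcl : ∀ p ∈ tbl,
        Complex.normSq (cfgDFT L (resid L Δ f) (B1.toTor L p.1.1) (B1.toTor L p.1.2))
          / (((L : ℝ) ^ 2) ^ 2 * den L (Tplus L Δ f) (B1.toTor L p.1.1) (B1.toTor L p.1.2))
        ≤ ((L : ℝ) ^ 2) ^ 2 * (2 * Real.pi / L) ^ 2 * ((p.2 : ℚ) : ℝ) := by
      intro p hp
      have hkk : p.1 ∈ lowList := htbl ▸ List.mem_map_of_mem hp
      have h1 := class_leC L Δ lam2 f czE hcz0 hwg hcz hL hΔ0 hΔ1 hf τlo τhi hτlo hτhi he1' hkk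
      have h2 := List.all_eq_true.mp hcls p hp
      unfold classCheckC at h2
      rw [hB] at h2
      have h3 := rexprLeOn_sound h2 _ hmem
      exact h1.trans (mul_le_mul_of_nonneg_left h3 (by positivity))
    have hsum' : lowGForm L Δ f ≤ ((L : ℝ) ^ 2) ^ 2 * (2 * Real.pi / L) ^ 2 * (((tbl.map Prod.snd).sum : ℚ) : ℝ) := by
      rw [lowGForm_eq_listsum L Δ f (by omega), ← htbl, List.map_map]
      have := listsum_le tbl _ (fun p => ((L : ℝ) ^ 2) ^ 2 * (2 * Real.pi / L) ^ 2 * ((p.2 : ℚ) : ℝ)) hcl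
      refine this.trans (le_of_eq ?_)
      rw [List.sum_map_mul_left, Rat.cast_list_sum, List.map_map]
      rfl
    -- the budget inequality in `ℝ`
    have hsumR : (((tbl.map Prod.snd).sum : ℚ) : ℝ) ≤ 3 * (98696 / 10000) * aD * ((c.n1 : ℝ) / c.νd) * τlo := by
      have := (Rat.cast_le (K := ℝ)).mpr hsum
      push_cast at this ⊢
      exact this
    have hπ2 : (98696 / 10000 : ℝ) ≤ Real.pi ^ 2 := by nlinarith [Real.pi_gt_d6, Real.pi_pos]
    have haD' : (0 : ℝ) ≤ aD := by exact_mod_cast haD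
    have hτ0' : (0 : ℝ) ≤ τlo := by exact_mod_cast hτlo0
    have hlam : 0 < lam2 := lam2_pos L (by omega) hΔ1 hf.1
    have hlt : 0 ≤ lam2 / (2 * Real.pi / L) ^ 2 := by positivity
    have hν' : 3 * (98696 / 10000) * (aD : ℝ) * ((c.n1 : ℝ) / c.νd) * τlo
        ≤ 3 * Real.pi ^ 2 * aD * (lam2 / (2 * Real.pi / L) ^ 2) * τlo := by
      have h1 : 0 ≤ (aD : ℝ) * τlo * (lam2 / (2 * Real.pi / L) ^ 2 - (c.n1 : ℝ) / c.νd) :=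
        mul_nonneg (mul_nonneg haD' hτ0') (sub_nonneg.2 hν1)
      have h2 : 0 ≤ (aD : ℝ) * τlo * (lam2 / (2 * Real.pi / L) ^ 2) * (Real.pi ^ 2 - 98696 / 10000) :=
        mul_nonneg (mul_nonneg (mul_nonneg haD' hτ0') hlt) (sub_nonneg.2 hπ2)
      nlinarith [h1, h2]
    have hRHS : (aD : ℝ) * etaEff L lam2 * Uunit L Δ f
        = ((L : ℝ) ^ 2) ^ 2 * (2 * Real.pi / L) ^ 2 * (3 * Real.pi ^ 2 * aD * (lam2 / (2 * Real.pi / L) ^ 2))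
          * (Tplus L Δ f / (2 * Real.pi / L) ^ 2) := by
      have hL0 : (L : ℝ) ≠ 0 := hLpos.ne'
      have hπ : Real.pi ≠ 0 := Real.pi_ne_zero
      unfold Uunit etaEff
      field_simp
      ring
    rw [hRHS]
    have hτ' : (τlo : ℝ) ≤ Tplus L Δ f / (2 * Real.pi / L) ^ 2 := by rw [le_div_iff₀ ht]; exact hτlo
    have hc0 : 0 ≤ ((L : ℝ) ^ 2) ^ 2 * (2 * Real.pi / L) ^ 2 * (3 * Real.pi ^ 2 * aD * (lam2 / (2 * Real.pi / L) ^ 2)) := by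
      positivity
    have hVt : 0 ≤ ((L : ℝ) ^ 2) ^ 2 * (2 * Real.pi / L) ^ 2 := by positivity
    calc lowGForm L Δ f ≤ ((L : ℝ) ^ 2) ^ 2 * (2 * Real.pi / L) ^ 2 * (((tbl.map Prod.snd).sum : ℚ) : ℝ) := hsum'
      _ ≤ ((L : ℝ) ^ 2) ^ 2 * (2 * Real.pi / L) ^ 2 * (3 * Real.pi ^ 2 * aD * (lam2 / (2 * Real.pi / L) ^ 2) * τlo) :=
          mul_le_mul_of_nonneg_left (hsumR.trans (by linarith)) hVt
      _ = ((L : ℝ) ^ 2) ^ 2 * (2 * Real.pi / L) ^ 2 * (3 * Real.pi ^ 2 * aD * (lam2 / (2 * Real.pi / L) ^ 2)) * τlo := by ring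
      _ ≤ _ := mul_le_mul_of_nonneg_left hτ' hc0

/-- ★★★ **PER-CLASS FORM of the `c_W` certificate** (same shape as `lowG_of_classChecksA`, with `classCheckW`). -/
theorem lowG_of_classChecksWA (c : L2.TCell) (a1 a2 aD τlo τhi : ℚ) (pi piT : ℕ × ℕ) (tbl : List (((ℤ × ℤ) × (ℤ × ℤ)) × ℚ))
    (htbl : tbl.map Prod.fst = lowList)
    (hcls : (tbl.all fun p => classCheckW c a1 a2 τlo τhi pi p.1 p.2) = true)
    (hsum : (tbl.map Prod.snd).sum ≤ 3 * (98696 / 10000) * aD * ((c.n1 : ℚ) / c.νd) * τlo)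
    (haD : 0 ≤ aD) (hτlo0 : 0 ≤ τlo) (he1 : e1Check c a1 a2 τhi pi = true) (hτ : tauCheck c a1 a2 τlo τhi piT = true)
    (hc : c.Adm) (hL : 64 ≤ L) (hL0 : c.L0 ≤ L) (hL1 : c.L1 = 0 ∨ L ≤ c.L1)
    (hΔ0 : 0 ≤ Δ) (hΔ1 : Δ < 1) (hf : IsGroundTwoMagnon L Δ lam2 f)
    (hν1 : (c.n1 : ℝ) / c.νd ≤ lam2 / (2 * Real.pi / L) ^ 2) (hν2 : lam2 / (2 * Real.pi / L) ^ 2 ≤ (c.n2 : ℝ) / c.νd)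
    (ha1 : ((a1 : ℚ) : ℝ) ≤ Δ * f (K1 L)) (ha2 : Δ * f (K1 L) ≤ ((a2 : ℚ) : ℝ)) :
    lowGForm L Δ f ≤ (aD : ℝ) * etaEff L lam2 * Uunit L Δ f := by
  obtain ⟨hcz0, hwg⟩ := wg_hypW L Δ lam2 f hL hΔ0 hΔ1 hf
  exact lowG_of_classChecksCA L Δ lam2 f cWE c hcz0 hwg (eval_cWE L Δ lam2 f hL hΔ0 hf) a1 a2 aD τlo τhi pi piT tbl htbl hcls hsum
    haD hτlo0 he1 hτ hc hL hL0 hL1 hΔ0 hΔ1 hf hν1 hν2 ha1 ha2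

/-- ★★★ **ORBIT FORM of the row-D cell certificate, generic zone constant**: representatives `reps = [(r_j, b_j)]` (each `r_j ∈ lowList` and passing ONE
kernel class check `classCheckC czE … r_j b_j`, `hrepsCls`; `r_j ∈ lowList`, `hrepsMem`), an orbit table `orb = [(k, j, w)]` listing `lowList` with `w·k = r_j` (`orbitRowOk`,
pure integer `decide`), the budget `Σ_k b_{j(k)} ≤ 3·(98696/10⁴)·a_D·ν₁·τlo`, the `ê₁` check and the `τ` check give
`lowGForm ≤ a_D·η_eff·U` on the cell for every `L ≥ 128` — the `hKT2a` hypothesis of `gm3_of_cell`. -/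
theorem lowG_of_orbitChecksCA (czE : RExpr) (c : L2.TCell) {cz : ℝ} (hcz0 : 0 ≤ cz)
    (hwg : ∀ q : Tor L, ∀ e ∈ E4, (wnorm L q (B1.toTor L e) * gres L lam2 q) ^ 2 ≤ cz * gres L lam2 q)
    (hcz : czE.eval (xTrueD L Δ lam2 f) = cz)
    (a1 a2 aD τlo τhi : ℚ) (pi piT : ℕ × ℕ)
    (reps : List (((ℤ × ℤ) × (ℤ × ℤ)) × ℚ)) (orb : List (((ℤ × ℤ) × (ℤ × ℤ)) × (ℕ × List ℕ)))
    (hrepsMem : (reps.all fun p => decide (p.1 ∈ lowList)) = true)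
    (hrepsCls : (reps.all fun p => classCheckC czE c a1 a2 τlo τhi pi p.1 p.2) = true)
    (horb : orb.map Prod.fst = lowList) (hok : (orb.all (orbitRowOk reps)) = true)
    (hsum : (orb.map (orbitBudget reps)).sum ≤ 3 * (98696 / 10000) * aD * ((c.n1 : ℚ) / c.νd) * τlo)
    (haD : 0 ≤ aD) (hτlo0 : 0 ≤ τlo) (he1 : e1Check c a1 a2 τhi pi = true) (hτ : tauCheck c a1 a2 τlo τhi piT = true)
    (hc : c.Adm) (hL : 64 ≤ L) (hL0 : c.L0 ≤ L) (hL1 : c.L1 = 0 ∨ L ≤ c.L1)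
    (hΔ0 : 0 ≤ Δ) (hΔ1 : Δ < 1) (hf : IsGroundTwoMagnon L Δ lam2 f)
    (hν1 : (c.n1 : ℝ) / c.νd ≤ lam2 / (2 * Real.pi / L) ^ 2) (hν2 : lam2 / (2 * Real.pi / L) ^ 2 ≤ (c.n2 : ℝ) / c.νd)
    (ha1 : ((a1 : ℚ) : ℝ) ≤ Δ * f (K1 L)) (ha2 : Δ * f (K1 L) ≤ ((a2 : ℚ) : ℝ)) :
    lowGForm L Δ f ≤ (aD : ℝ) * etaEff L lam2 * Uunit L Δ f := by
  obtain ⟨hτlo, hτhi⟩ := tau_of_tauCheckA L Δ lam2 f c a1 a2 τlo τhi piT hτ hc hL hL0 hL1 hΔ0 hΔ1 hf hν1 hν2 ha1 ha2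
  -- the box and the `ê₁` check
  unfold e1Check at he1
  split at he1
  · exact absurd he1 (by simp)
  · rename_i B hB
    have hmem := rowDBox_memA L Δ lam2 f c a1 a2 pi hB hc hL hL0 hL1 hΔ0 hΔ1 hf hν1 hν2 ha1 ha2
    have e1 := rexprLeOn_sound he1 _ hmem
    simp only [RExpr.eval, cst, vE1, xTrueD_e1] at e1
    push_cast at e1
    have he1' : (τhi : ℝ) - 2 * (eps1 L / (2 * Real.pi / L) ^ 2) ≤ -1 / 1000 := by linarith
    -- the representatives: `T(r_j) ≤ V²t·b_j`
    have hrep : ∀ r ∈ reps, lowTerm L Δ f (B1.toTor L r.1.1) (B1.toTor L r.1.2)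
        ≤ ((L : ℝ) ^ 2) ^ 2 * (2 * Real.pi / L) ^ 2 * ((r.2 : ℚ) : ℝ) := by
      intro r hr
      have hmemL : r.1 ∈ lowList := of_decide_eq_true (List.all_eq_true.mp hrepsMem r hr)
      have hcls := List.all_eq_true.mp hrepsCls r hr
      have h1 := class_leC L Δ lam2 f czE hcz0 hwg hcz hL hΔ0 hΔ1 hf τlo τhi hτlo hτhi he1' hmemL
      unfold classCheckC at hcls
      rw [hB] at hcls
      have h3 := rexprLeOn_sound hcls _ hmem
      exact h1.trans (mul_le_mul_of_nonneg_left h3 (by positivity))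
    -- the rows: `T(k) = T(w·k) = T(r_j) ≤ V²t·b_j`
    refine lowG_of_rowBounds L Δ lam2 f (by omega) hΔ1 hf c aD τlo (orb.map fun row => (row.1, orbitBudget reps row))
      (by rw [List.map_map]; exact horb) ?_ (by rw [List.map_map]; exact hsum) haD hτlo0 hτlo hν1
    intro p hp
    obtain ⟨row, hrow, rfl⟩ := List.mem_map.mp hp
    have hok1 := List.all_eq_true.mp hok row hrow
    unfold orbitRowOk at hok1
    unfold orbitBudget
    split at hok1
    · exact absurd hok1 (by simp)
    · rename_i r hr
      have hw : wordZ row.2.2 row.1 = r.1 := of_decide_eq_true hok1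
      have hrmem : r ∈ reps := List.mem_of_getElem? hr
      have key := lowTerm_wordZ L (by omega) hf row.2.2 row.1
      rw [hw] at key
      show lowTerm L Δ f (B1.toTor L row.1.1) (B1.toTor L row.1.2) ≤ _
      rw [← key]
      exact hrep r hrmem

/-- ★★★ **ORBIT FORM of the `c_W` certificate** (same shape as `lowG_of_orbitChecksA`, with `classCheckW`): six kernel class checks of
the `c_W` program + the orbit table + budget + `ê₁`/`τ` checks ⟹ `lowGForm ≤ a_D·η_eff·U` on the cell for every `L ≥ 128`. -/
theorem lowG_of_orbitChecksWA (c : L2.TCell) (a1 a2 aD τlo τhi : ℚ) (pi piT : ℕ × ℕ)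
    (reps : List (((ℤ × ℤ) × (ℤ × ℤ)) × ℚ)) (orb : List (((ℤ × ℤ) × (ℤ × ℤ)) × (ℕ × List ℕ)))
    (hrepsMem : (reps.all fun p => decide (p.1 ∈ lowList)) = true)
    (hrepsCls : (reps.all fun p => classCheckW c a1 a2 τlo τhi pi p.1 p.2) = true)
    (horb : orb.map Prod.fst = lowList) (hok : (orb.all (orbitRowOk reps)) = true)
    (hsum : (orb.map (orbitBudget reps)).sum ≤ 3 * (98696 / 10000) * aD * ((c.n1 : ℚ) / c.νd) * τlo)
    (haD : 0 ≤ aD) (hτlo0 : 0 ≤ τlo) (he1 : e1Check c a1 a2 τhi pi = true) (hτ : tauCheck c a1 a2 τlo τhi piT = true)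
    (hc : c.Adm) (hL : 64 ≤ L) (hL0 : c.L0 ≤ L) (hL1 : c.L1 = 0 ∨ L ≤ c.L1)
    (hΔ0 : 0 ≤ Δ) (hΔ1 : Δ < 1) (hf : IsGroundTwoMagnon L Δ lam2 f)
    (hν1 : (c.n1 : ℝ) / c.νd ≤ lam2 / (2 * Real.pi / L) ^ 2) (hν2 : lam2 / (2 * Real.pi / L) ^ 2 ≤ (c.n2 : ℝ) / c.νd)
    (ha1 : ((a1 : ℚ) : ℝ) ≤ Δ * f (K1 L)) (ha2 : Δ * f (K1 L) ≤ ((a2 : ℚ) : ℝ)) :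
    lowGForm L Δ f ≤ (aD : ℝ) * etaEff L lam2 * Uunit L Δ f := by
  obtain ⟨hcz0, hwg⟩ := wg_hypW L Δ lam2 f hL hΔ0 hΔ1 hf
  exact lowG_of_orbitChecksCA L Δ lam2 f cWE c hcz0 hwg (eval_cWE L Δ lam2 f hL hΔ0 hf) a1 a2 aD τlo τhi pi piT reps orb
    hrepsMem hrepsCls horb hok hsum haD hτlo0 he1 hτ hc hL hL0 hL1 hΔ0 hΔ1 hf hν1 hν2 ha1 ha2

end T

end RowD

end Summit.HubbardSuperconductivity.HubbardSuperconductivity.Theorems.AnisotropyChord.Transfer.Fibre3
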